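import Summits.KontsevichZagierPeriods.KontsevichZagierPeriods.Theorems.LinRedNormalFormHoffmanSpanInKZTablesZ

/-!
# Crux `LinRedNormalForm.HoffmanSpanInKZ` (stmt-KontsevichZagierPeriods-15044), line `Sketch`:
# transcript checkers with a SORTED-MERGE accumulator (registered stub `stub_derivedMerge`)

The transcript checkers `dtableOk'` / `wtableOk'` (`LinRedNormalFormHoffmanSpanInKZDerivedFast`) test a row by
expanding `g + Σ_L c_k · V_k − V` into ONE formal combination and running the radix zero test on it.  From weight
`11` on the late rows of the elimination cite `100–250` earlier rows of `40–60` entries each, and the kernel's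
evaluation of the radix split of a `4000`-term combination recurses as deep as the combination is long (observed:
rows with `≲ 1700` terms check, the weight-`11` core rows with `2000–4500` terms do not).  This file checks the
same row identity with an ACCUMULATOR kept as an association list sorted by word (`ltW`, lexicographic): the
claimed vector (scaled by `−1`) is the initial accumulator, the generator's terms are inserted one by one (`insW`),
and each cited vector is merged in with its coefficient (`mergeW`, one linear pass, equal words combined, zeros
dropped); the row checks iff the final accumulator is empty (complete when the claimed vectors are listed in
increasing `ltW` order, which the table generator does; soundness needs no sortedness).  The recursion depth is now bounded by the length of
the accumulator (the number of distinct words in play) and by the number of citations, not by the total number of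
terms.  Soundness: `insW` / `mergeW` realise to the expected sums (`eval_insW`, `eval_mergeW`), so the final
accumulator realises to the realisation of the old expansion (`eval_drowAcc`, `eval_wrowAcc`); the table
soundness statements (`clause_of_dtableOkM`, `clause_of_wtableOkM`, `edsCertificate_of_dwtablesM`) and the
splitting lemmas are those of the Derived file verbatim.  The merge functions are written for any coefficient type
(structural recursions only, so that `decide +kernel` evaluates them).

Sources: the reflection set-up of `MzvKernelInKZTwoPosetsEdsCertificateLow`, `LinRedNormalFormHoffmanSpanInKZDerived`
(this tree); sorted sparse accumulation is folklore ("sparse axpy"). [folklore]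
-/

namespace Summit.KontsevichZagierPeriods.LinRedNormalForm.HoffmanSpanInKZ

open Literature.NumberTheory.Transcendental
open Summit.KontsevichZagierPeriods.MzvKernelInKZ.Negative
open Summit.KontsevichZagierPeriods.MzvKernelInKZ.TwoPosets

/-! ## Sorted sparse accumulation (generic coefficients) -/

/-- Lexicographic comparison of words (`false < true`), as a Boolean. [folklore] -/
def ltW : List Bool → List Bool → Bool
  | [], [] => false
  | [], _ :: _ => true
  | _ :: _, [] => false
  | a :: u, b :: v => (!a && b) || (a == b && ltW u v)

/-- Insert-add one term `(w, c)` into an association list kept sorted by `ltW` (equal words combined, a zero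
sum dropped). [folklore] -/
def insW (w : List Bool) (c : ℚ) : FVec → FVec
  | [] => [(w, c)]
  | (w', c') :: l =>
    if w = w' then (if c + c' = 0 then l else (w', c + c') :: l)
    else if ltW w w' then (w, c) :: (w', c') :: l
    else (w', c') :: insW w c l

/-- Inner recursion of `mergeW` on the accumulator: merge the term `p` (already scaled) followed by the scaled
rest of the vector (`contV`, the outer recursion as a continuation) into the accumulator. [folklore] -/
def mergeWAux (p : List Bool × ℚ) (contV : FVec → FVec) : FVec → FVec
  | [] => p :: contV []
  | (w', x') :: acc =>
    if p.1 = w' then (if p.2 + x' = 0 then contV acc else (w', p.2 + x') :: contV acc)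
    else if ltW p.1 w' then p :: contV ((w', x') :: acc)
    else (w', x') :: mergeWAux p contV acc

/-- Merge `c • v` into the accumulator `acc` (both sorted by `ltW`; one linear pass). [folklore] -/
def mergeW (c : ℚ) : FVec → FVec → FVec
  | [] => fun acc => acc
  | (w, x) :: v => mergeWAux (w, c * x) (mergeW c v)

/-! ## Realisation lemmas over `ℚ` -/

section Eval

variable {N : ℕ}

/-- `insW` adds one term to the realisation. [folklore] -/
theorem eval_insW (w : List Bool) (c : ℚ) :
    ∀ l : FVec, FVec.eval N (insW w c l) = c • unitVec N (wordOf N w) + FVec.eval N l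
  | [] => by simp [insW]
  | (w', c') :: l => by
    unfold insW
    split_ifs with h1 h2 h3
    · subst h1
      rw [FVec.eval_cons, ← add_assoc, ← add_smul, h2, zero_smul, zero_add]
    · subst h1
      rw [FVec.eval_cons, FVec.eval_cons, add_smul, add_assoc]
    · rw [FVec.eval_cons]
    · rw [FVec.eval_cons, FVec.eval_cons, eval_insW w c l]
      abel

/-- `mergeWAux` realises to the term plus the continuation's contribution, given the continuation's law.
[folklore] -/
theorem eval_mergeWAux (p : List Bool × ℚ) (contV : FVec → FVec) (e : Vec N)
    (hcont : ∀ acc, FVec.eval N (contV acc) = e + FVec.eval N acc) :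
    ∀ acc : FVec, FVec.eval N (mergeWAux p contV acc) =
      p.2 • unitVec N (wordOf N p.1) + e + FVec.eval N acc
  | [] => by simp only [mergeWAux, FVec.eval_cons, hcont, FVec.eval_nil]; abel
  | (w', x') :: acc => by
    unfold mergeWAux
    split_ifs with h1 h2 h3
    · rw [hcont, FVec.eval_cons, ← h1]
      have : p.2 • unitVec N (wordOf N p.1) + x' • unitVec N (wordOf N p.1) = 0 := by
        rw [← add_smul, h2, zero_smul]
      rw [show p.2 • unitVec N (wordOf N p.1) + e + (x' • unitVec N (wordOf N p.1) + FVec.eval N acc) =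
        (p.2 • unitVec N (wordOf N p.1) + x' • unitVec N (wordOf N p.1)) + (e + FVec.eval N acc) by abel,
        this, zero_add]
    · rw [FVec.eval_cons, hcont, FVec.eval_cons, ← h1, add_smul]
      abel
    · rw [FVec.eval_cons, hcont, FVec.eval_cons]
      abel
    · rw [FVec.eval_cons, FVec.eval_cons, eval_mergeWAux p contV e hcont acc]
      abel

/-- `mergeW c v acc` realises to `c • v + acc`. [folklore] -/
theorem eval_mergeW (c : ℚ) : ∀ (v acc : FVec), FVec.eval N (mergeW c v acc) = c • FVec.eval N v + FVec.eval N acc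
  | [], acc => by simp [mergeW]
  | (w, x) :: v, acc => by
    rw [mergeW, eval_mergeWAux (w, c * x) (mergeW c v) (c • FVec.eval N v) (eval_mergeW c v) acc,
      FVec.eval_cons, smul_add, mul_smul]

/-- Folding `insW` over a list of terms adds their realisation. [folklore] -/
theorem eval_foldl_insW : ∀ (g : FVec) (acc : FVec),
    FVec.eval N (g.foldl (fun a p => insW p.1 p.2 a) acc) = FVec.eval N g + FVec.eval N acc
  | [], acc => by simp
  | p :: g, acc => by
    rw [List.foldl_cons, eval_foldl_insW g, eval_insW, FVec.eval_cons]
    abel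

/-- Folding `mergeW` over citations adds the realisation of the cited combination. [folklore] -/
theorem eval_foldl_mergeW (mem : List FVec) (f : ℤ × ℕ → ℚ) : ∀ (L : List (ℕ × ℤ × ℕ)) (acc : FVec),
    FVec.eval N (L.foldl (fun a p => mergeW (f p.2) (mem.getD p.1 []) a) acc) =
      FVec.eval N (L.flatMap fun p => FVec.smul (f p.2) (mem.getD p.1 [])) + FVec.eval N acc
  | [], acc => by simp
  | p :: L, acc => by
    rw [List.foldl_cons, eval_foldl_mergeW mem f L, eval_mergeW, List.flatMap_cons, FVec.eval_append,
      FVec.eval_smul]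
    abel

end Eval

/-! ## The checkers -/

/-- The accumulator of a derived row: `−V`, then the generator's terms inserted, then the citations merged in.
[folklore] -/
def DRow.acc (N : ℕ) (mem : List FVec) (d : DRow) : FVec :=
  d.L.foldl (fun a p => mergeW (qOf p.2) (mem.getD p.1 []) a)
    ((d.g.fvec N).foldl (fun a p => insW p.1 p.2 a) (FVec.smul (-1) d.vfvec))

/-- The accumulator realises to the realisation of the row expansion `DRow.fvec`. [folklore] -/
theorem eval_drowAcc (N : ℕ) (mem : List FVec) (d : DRow) :
    FVec.eval N (d.acc N mem) = FVec.eval N (d.fvec N mem) := by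
  rw [DRow.acc, eval_foldl_mergeW, eval_foldl_insW, DRow.fvec, FVec.eval_append, FVec.eval_append]
  abel

/-- Derived-row checker (merge accumulator): side conditions and empty final accumulator. [folklore] -/
def drowOkM (N : ℕ) (mem : List FVec) (d : DRow) : Bool :=
  d.g.ok N && (d.acc N mem).isEmpty

/-- Derived-table checker (merge accumulator). [folklore] -/
def dtableOkM (N : ℕ) : List FVec → List DRow → Bool
  | _, [] => true
  | mem, d :: ds => drowOkM N mem d && dtableOkM N (mem ++ [d.vfvec]) ds

/-- The accumulator of a word row: `e_w`, cited words and Hoffman words inserted with negated coefficients,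
cited derived vectors merged in with negated coefficients. [folklore] -/
def WRow.acc (dv : List FVec) (c : WRow) : FVec :=
  c.E.foldl (fun a p => mergeW (-qOf p.2) (dv.getD p.1 []) a)
    (((c.P.map fun p => (MZV.binaryWord p.1, -qOf p.2)) ++
        (c.H.map fun p => (MZV.binaryWord p.1, -qOf p.2))).foldl (fun a p => insW p.1 p.2 a)
      [(MZV.binaryWord c.w, 1)])

/-- The word-row accumulator realises to the realisation of the row expansion `WRow.fvec`. [folklore] -/
theorem eval_wrowAcc (N : ℕ) (dv : List FVec) (c : WRow) :
    FVec.eval N (c.acc dv) = FVec.eval N (c.fvec dv) := by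
  rw [WRow.acc, eval_foldl_mergeW dv (fun p => -qOf p), eval_foldl_insW]
  simp only [WRow.fvec, FVec.eval_cons, FVec.eval_append, FVec.eval_nil]
  abel

/-- Word-row checker (merge accumulator). [folklore] -/
def wrowOkM (N : ℕ) (dv : List FVec) (prev : List (List ℕ)) (c : WRow) : Bool :=
  decide (∀ p ∈ c.H, MZV.IsHoffman p.1 ∧ MZV.weight p.1 = N) &&
  c.P.all (fun p => prev.contains p.1) && (c.acc dv).isEmpty

/-- Word-table checker (merge accumulator). [folklore] -/
def wtableOkM (N : ℕ) (dv : List FVec) : List (List ℕ) → List WRow → Bool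
  | _, [] => true
  | prev, c :: T => wrowOkM N dv prev c && wtableOkM N dv (c.w :: prev) T

section Soundness

/-- An empty accumulator realises to `0`. [folklore] -/
theorem eval_eq_zero_of_isEmpty (N : ℕ) {v : FVec} (h : v.isEmpty = true) : FVec.eval N v = 0 := by
  rw [List.isEmpty_iff] at h
  subst h
  rfl

/-- Soundness of one derived row (merge accumulator). [folklore] -/
theorem clause_of_drowOkM {N : ℕ} (mem : List FVec) (hmem : ∀ v ∈ mem, Clause N (FVec.eval N v)) (d : DRow)
    (h : drowOkM N mem d = true) : Clause N (FVec.eval N d.vfvec) := by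
  simp only [drowOkM, Bool.and_eq_true] at h
  obtain ⟨hg, hz⟩ := h
  have h0 : FVec.eval N (d.fvec N mem) = 0 := by rw [← eval_drowAcc]; exact eval_eq_zero_of_isEmpty N hz
  rw [DRow.fvec, FVec.eval_append, FVec.eval_append, FVec.eval_smul, neg_one_smul,
    ← sub_eq_add_neg, sub_eq_zero] at h0
  rw [← h0]
  exact clause_add (Gen.clause N d.g hg) (clause_eval_flatMap_mem mem hmem d.L qOf)

/-- Soundness of the derived-table checker (merge accumulator). [folklore] -/
theorem clause_of_dtableOkM {N : ℕ} :
    ∀ (T : List DRow) (mem : List FVec), (∀ v ∈ mem, Clause N (FVec.eval N v)) →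
      dtableOkM N mem T = true → ∀ v ∈ mem ++ T.map DRow.vfvec, Clause N (FVec.eval N v) := by
  intro T
  induction T with
  | nil => intro mem hmem _ v hv; simpa using hmem v (by simpa using hv)
  | cons d T ih =>
    intro mem hmem h v hv
    simp only [dtableOkM, Bool.and_eq_true] at h
    obtain ⟨hd, hT⟩ := h
    have hdv : Clause N (FVec.eval N d.vfvec) := clause_of_drowOkM mem hmem d hd
    have hmem' : ∀ v ∈ mem ++ [d.vfvec], Clause N (FVec.eval N v) := by
      intro v hv
      rcases List.mem_append.1 hv with h' | h'
      · exact hmem v h'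
      · simp only [List.mem_singleton] at h'
        subst h'
        exact hdv
    refine ih (mem ++ [d.vfvec]) hmem' hT v ?_
    simpa [List.append_assoc] using hv

/-- Splitting a derived-table check at an append (merge accumulator). [folklore] -/
theorem dtableOkM_append (N : ℕ) :
    ∀ (A B : List DRow) (mem : List FVec), dtableOkM N mem A = true →
      dtableOkM N (mem ++ A.map DRow.vfvec) B = true → dtableOkM N mem (A ++ B) = true := by
  intro A
  induction A with
  | nil => intro B mem _ h; simpa using h
  | cons d A ih =>
    intro B mem h₁ h₂
    simp only [dtableOkM, List.cons_append, Bool.and_eq_true] at h₁ ⊢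
    refine ⟨h₁.1, ih B (mem ++ [d.vfvec]) h₁.2 ?_⟩
    simpa [List.append_assoc] using h₂

/-- Soundness of one word row (merge accumulator). [folklore] -/
theorem clause_of_wrowOkM {N : ℕ} (dv : List FVec) (hdv : ∀ v ∈ dv, Clause N (FVec.eval N v))
    (prev : List (List ℕ)) (hprev : ∀ w ∈ prev, Clause N (unitVec N (bword N w))) (c : WRow)
    (h : wrowOkM N dv prev c = true) : Clause N (unitVec N (bword N c.w)) := by
  simp only [wrowOkM, Bool.and_eq_true, decide_eq_true_eq, List.all_eq_true] at h
  obtain ⟨⟨hH, hP⟩, hz⟩ := h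
  have h0 : FVec.eval N (c.fvec dv) = 0 := by rw [← eval_wrowAcc]; exact eval_eq_zero_of_isEmpty N hz
  rw [WRow.fvec, FVec.eval_append, FVec.eval_cons, FVec.eval_append, eval_map_neg, eval_map_neg,
    eval_flatMap_neg, one_smul] at h0
  have h1 : unitVec N (bword N c.w) =
      (c.P.map fun p => qOf p.2 • unitVec N (bword N p.1)).sum +
        ((c.H.map fun p => qOf p.2 • unitVec N (bword N p.1)).sum +
          FVec.eval N (c.E.flatMap fun p => FVec.smul (qOf p.2) (dv.getD p.1 []))) := by
    rw [← sub_eq_zero, ← h0]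
    simp only [bword]
    abel
  rw [h1]
  refine clause_add ?_ (clause_add ?_ (clause_eval_flatMap_mem dv hdv c.E qOf))
  · have := clause_sum_refs (N := N) (c.P.map fun p => (p.1, qOf p.2)) fun p hp => by
      obtain ⟨p', hp', rfl⟩ := List.mem_map.1 hp
      exact hprev p'.1 (List.contains_iff_mem.1 (hP p' hp'))
    simpa [List.map_map, Function.comp_def] using this
  · have := clause_hoffman (N := N) (c.H.map fun p => (p.1, qOf p.2)) fun p hp => by
      obtain ⟨p', hp', rfl⟩ := List.mem_map.1 hp
      exact hH p' hp'
    simpa [List.map_map, Function.comp_def] using this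

/-- Soundness of the word-table checker (merge accumulator). [folklore] -/
theorem clause_of_wtableOkM {N : ℕ} (dv : List FVec) (hdv : ∀ v ∈ dv, Clause N (FVec.eval N v)) :
    ∀ (T : List WRow) (prev : List (List ℕ)), (∀ w ∈ prev, Clause N (unitVec N (bword N w))) →
      wtableOkM N dv prev T = true → ∀ c ∈ T, Clause N (unitVec N (bword N c.w)) := by
  intro T
  induction T with
  | nil => intro _ _ _ c hc; simp at hc
  | cons c T ih =>
    intro prev hprev h c' hc'
    simp only [wtableOkM, Bool.and_eq_true] at h
    obtain ⟨hc, hT⟩ := h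
    have hcw : Clause N (unitVec N (bword N c.w)) := clause_of_wrowOkM dv hdv prev hprev c hc
    rcases List.mem_cons.1 hc' with rfl | hmem
    · exact hcw
    · refine ih (c.w :: prev) ?_ hT c' hmem
      intro w hw
      rcases List.mem_cons.1 hw with rfl | hw'
      exacts [hcw, hprev w hw']

/-- Splitting a word-table check at an append (merge accumulator). [folklore] -/
theorem wtableOkM_append (N : ℕ) (dv : List FVec) :
    ∀ (T₁ T₂ : List WRow) (prev : List (List ℕ)),
      wtableOkM N dv prev T₁ = true → wtableOkM N dv ((T₁.map WRow.w).reverse ++ prev) T₂ = true →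
        wtableOkM N dv prev (T₁ ++ T₂) = true := by
  intro T₁
  induction T₁ with
  | nil => intro T₂ prev _ h; simpa using h
  | cons c T₁ ih =>
    intro T₂ prev h₁ h₂
    simp only [wtableOkM, List.cons_append, Bool.and_eq_true] at h₁ ⊢
    refine ⟨h₁.1, ih T₂ (c.w :: prev) h₁.2 ?_⟩
    simpa [List.map_cons, List.reverse_cons, List.append_assoc] using h₂

/-- **From checked tables (merge accumulator) to `EdsCertificate N`.** [folklore] -/
theorem edsCertificate_of_dwtablesM (N : ℕ) (Δ : List DRow) (T : List WRow)
    (hΔ : dtableOkM N [] Δ = true) (hT : wtableOkM N (Δ.map DRow.vfvec) [] T = true)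
    (hcover : ∀ ε : Fin N → Bool, Adm ε → ∃ c ∈ T, bword N c.w = ε) : EdsCertificate N := by
  have hdv : ∀ v ∈ Δ.map DRow.vfvec, Clause N (FVec.eval N v) := fun v hv =>
    clause_of_dtableOkM Δ [] (fun v hv => by simp at hv) hΔ v (by simpa using hv)
  intro ε hε
  obtain ⟨c, hc, rfl⟩ := hcover ε hε
  exact clause_of_wtableOkM _ hdv T [] (fun w hw => by simp at hw) hT c hc

end Soundness

/-! ## The registered stub -/

/-- Soundness of the two-table format with the merge-accumulator checkers, for converted compact tables, as a
statement about this file's own checkers (not a published fact). -/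
def DerivedMergeSound : Prop :=
  ∀ (N : ℕ) (Δ : List DRowZ) (T : List WRowZ), dtableOkM N [] (dtabOf N Δ) = true →
    wtableOkM N ((dtabOf N Δ).map DRow.vfvec) [] (wtabOf N T) = true →
      (∀ ε : Fin N → Bool, Adm ε → ∃ c ∈ wtabOf N T, bword N c.w = ε) → EdsCertificate N

/-- **Registered stub `stub_derivedMerge`** of the skeleton of line `Sketch` (checkers for the weight-`11`/`12`
tables). -/
theorem stub_derivedMerge : DerivedMergeSound := fun N Δ T =>
  edsCertificate_of_dwtablesM N (dtabOf N Δ) (wtabOf N T)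

/-! ## Smoke test (kernel), weight `4`: the compact tables of the TablesZ file's smoke test -/

example : dtableOkM 4 [] (dtabOf 4
    [⟨.F [2] [2], [], 1, [(1, -1), (3, 4)]⟩,
     ⟨.D [3], [(0, 1, 4)], 4, [(1, 3), (5, -4)]⟩,
     ⟨.K [2, 1, 1], [], 1, [(1, -1), (7, 1)]⟩]) = true := by
  decide +kernel

example : wtableOkM 4 ((dtabOf 4
    [⟨.F [2] [2], [], 1, [(1, -1), (3, 4)]⟩,
     ⟨.D [3], [(0, 1, 4)], 4, [(1, 3), (5, -4)]⟩,
     ⟨.K [2, 1, 1], [], 1, [(1, -1), (7, 1)]⟩]).map DRow.vfvec) [] (wtabOf 4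
    [⟨5, 1, [], [(5, 1)], []⟩,
     ⟨1, 3, [], [(5, 4)], [(1, 4)]⟩,
     ⟨3, 4, [(1, 1)], [], [(0, 1)]⟩,
     ⟨7, 1, [(1, 1)], [], [(2, 1)]⟩]) = true := by
  decide +kernel

end Summit.KontsevichZagierPeriods.LinRedNormalForm.HoffmanSpanInKZ
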